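import Literature.Analysis.FluidPDE.NecasRuzickaSverak1996
import Literature.Analysis.FluidPDE.CKNEpsilonRegularity
import Literature.Analysis.FluidPDE.ClassicalSuitable
import Literature.Analysis.FluidPDE.TsaiLocalEnergyScaling
import Literature.Analysis.FluidPDE.TsaiProfileEndgame
import HarnessLib

/-!
# Nečas–Růžička–Šverák 1996 via ε-regularity: `L³` Leray profiles decay like `|y|⁻¹`

Analysis/FluidPDE file (family NS, statement ns.S21), second layer of the decomposition of the
named fact `Literature.Analysis.FluidPDE.necas_ruzicka_sverak` (`SelfSimilarLiouville.lean`;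
J. Nečas, M. Růžička, V. Šverák, *On Leray's self-similar solutions of the Navier–Stokes
equations*, Acta Math. 176 (1996) 283–294, **Theorem 1**: a weak solution `U ∈ L³(ℝ³)` of
Leray's profile system (1.3) vanishes). The first layer (`NecasRuzickaSverak1996.lean`) proved
Theorem 1 from the regularity of profiles and NRŠ's Lemma 3.2 in full strength (decay of all
derivatives of `U` and `P`, named fact `nrs1996_lemma32`). The endgame, however, only consumes
growth information of order zero — Tsai's form of the argument (ARMA 143 (1998), §5) needs
`U(y) = o(|y|)` and `P(y) = O(|y|^N)` —, and for these the printed proof of Lemma 3.2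
(pp. 288–290) needs only its *first* step: the one-scale ε-regularity criterion of
Caffarelli–Kohn–Nirenberg applied to the self-similar solution `u(t, x) = λ(t) U(λ(t) x)`,
`λ(t) = (2a(T − t))^{-1/2}`, near the points `(x₀, T)`, `x₀ ≠ 0` ((3.5)–(3.6) with `k = 0`), and
the rescaling (3.3). This file **proves** that step from the tree's named rendering of the
criterion and isolates the one remaining input, the `L^{3/2}` pressure of Lemma 3.1:

* `nrs1996_lemma31` — **named fact** (NRŠ Lemma 3.1 with the Calderón–Zygmund bound of §2,
  p. 285, rendered for the pointwise profile class, see its docstring): an `L³` profile has a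
  constant `c` with `P − c ∈ L^{3/2}(ℝ³)`;
* `epsilonRegularity_of_isSuitableWeakSolutionOn` — **proved**: Lemarié-Rieusset's Theorem 14.4
  (`lemarieRieusset_epsilon_regularity`, `CKNEpsilonRegularity.lean`) for the accepted local class
  `IsSuitableWeakSolutionOn` (zero force): `∫∫_{Q_{r₀}(z₀)} (|u|³ + |p|^{3/2}) ≤ ε₀³ r₀²` on a
  cylinder whose closed box `[t₀ − r₁², t₀] × B̄_{r₁}(x₀)` lies in the region gives
  `|u| ≤ C₀ ε₀ / r₀` a.e. on `Q_{r₀/2}(z₀)`;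
* `IsLerayProfile.exists_forall_norm_mul_norm_le_of_oneScale` — **proved** (NRŠ (3.5)–(3.6),
  `k = 0`, and (3.3); Tsai 1998, (3.11)): for `ν, a > 0`, a `C²` Leray profile `U ∈ L³(ℝ³)` whose
  pressure satisfies `P − c ∈ L^{3/2}` obeys `|y| |U(y)| ≤ C` for `|y| ≥ R`, *granted* the
  conclusion of the one-scale criterion for the accepted local class at viscosity `ν` (the shape
  proved in `epsilonRegularity_of_isSuitableWeakSolutionOn`), taken as an explicit hypothesis so
  that any rendering of Caffarelli–Kohn–Nirenberg's Proposition 1 — Lemarié-Rieusset's Thm. 14.4,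
  Robinson–Rodrigo–Sadowski's Thm. 15.3 — can be plugged in;
  `IsLerayProfile.exists_forall_norm_mul_norm_le` — **proved**: its instance fed by
  `lemarieRieusset_epsilon_regularity`;
* `necas_ruzicka_sverak_of_epsilonRegularity` — **proved** assembly:
  `tsai1998_profile_smooth → tsai1998_lemma32 → lemarieRieusset_epsilon_regularity →
   nrs1996_lemma31 → necas_ruzicka_sverak`.

So `necas_ruzicka_sverak` now rests on the regularity of profiles (`tsai1998_profile_smooth`,
Tsai p. 33 = NRŠ p. 287), Tsai's Lemma 3.2 (`tsai1998_lemma32`, stated in the tree for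
`3 ≤ q ≤ ∞`, pressure growth), the Caffarelli–Kohn–Nirenberg one-scale criterion
(`lemarieRieusset_epsilon_regularity`) and the Calderón–Zygmund pressure (`nrs1996_lemma31`) —
the first three shared with the decompositions of Tsai's Theorems 1 and 2
(`TsaiProfileEndgame`, `TsaiLocalEnergy`).

## The proof of the decay (NRŠ pp. 288–290, order zero)

Let `u = lerayBackward a T U`, `p(t, x) = λ(t)² (P(λ(t)x) − c)`; by Leray's reduction
(`IsLerayProfile.momentum_lerayBackward`, `LeraySelfSimilarCalculus`) `(u, p)` is a `C²/C¹`
classical solution of Navier–Stokes on `{t < T} × ℝ³`, hence a suitable weak solution there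
(`isSuitableWeakSolutionOn_of_contDiffOn`, `ClassicalSuitable`). (3.5): for `|x₀| = 1`,
`r₀ ≤ 1/2` and `t < T` with `λ(t) ≥ 2ρ`, the substitution `y = λ(t) x` gives
`∫_{B_{r₀}(x₀)} |u(t)|³ dx ≤ ∫_{|y| ≥ ρ} |U|³`, `∫_{B_{r₀}(x₀)} |p(t)|^{3/2} dx ≤ ∫_{|y| ≥ ρ} |P − c|^{3/2}`
(both sides are scale invariant and `λ B_{r₀}(x₀) ⊆ {|y| ≥ λ/2}`), and the right-hand sides
tend to `0` as `ρ → ∞` (`U ∈ L³`, `P − c ∈ L^{3/2}`; dominated convergence). Hence for `t₀ < T`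
close to `T` the cylinder `Q_{r₀}(t₀, x₀)` (with `r₀² ≤ δ/2`, `δ = (8aρ²)⁻¹`) carries
`∫∫ (|u|³ + |p|^{3/2}) ≤ ε₀³ r₀²`, uniformly in the direction `x₀`, and (3.6) with `k = 0`:
`|u| ≤ C₀ε₀/r₀` a.e. on `Q_{r₀/2}(t₀, x₀)` — everywhere, `u` being continuous below `T` —, in
particular at `(t, x₀)` for every `T − δ' < t < T`. Finally (3.3): for `|y|` large put
`t = T − (2a|y|²)⁻¹`, so that `λ(t) = |y|`, and `x₀ = y/|y|`; then `u(t, x₀) = |y| U(y)`.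

## Design notes

* The cylinders are taken strictly below the blow-up time (`t₀ < T`), where every integrability
  hypothesis of Theorem 14.4 is free (continuity on the compact box); only the *quantitative*
  conclusion `C₀ ε₀ / r₀`, uniform in `t₀ ↑ T`, is used. NRŠ apply their Proposition 2.1 on
  `Q_R(x₀, T)` itself; the difference is immaterial for `k = 0`.
* `nrs1996_lemma31` keeps the shape of the sibling facts (`nrs1996_lemma32`, Tsai's
  `tsai1998_pressure_L53w`): stated for the pointwise class `IsLerayProfile ν a U P`, whose `P`
  has the gradient of NRŠ's `RⱼRₖ(UⱼUₖ)` and hence differs from it by a constant. Its natural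
  discharge is the unweighted twin of `TsaiSelfSimilarPressureProofs` (Tsai's Lemma 2.1
  identification, proved there in `L^{5/3}_w`) on top of the `L^{3/2}` boundedness of `RⱼRₖ`.
* No statement of `SelfSimilarLiouville.lean` or `NecasRuzickaSverak1996.lean` is touched.

## Mathlib / tree search

Mathlib: `tendsto_lintegral_filter_of_dominated_convergence`, `Measure.map_addHaar_smul` (through
the tree's `lintegral_comp_smul_fin3`), `IsOpen.measure_pos`, `Real.volume_Ioo`,
`eLpNorm_lt_top_iff_lintegral_rpow_enorm_lt_top`. Tree: `lemarieRieusset_epsilon_regularity`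
(`CKNEpsilonRegularity`); `isSuitableWeakSolutionOn_of_contDiffOn` (`ClassicalSuitable`);
`IsLerayProfile.momentum_lerayBackward`, `contDiffOn_uncurry_lerayBackward`,
`contDiffOn_uncurry_lerayBackwardPressure_sub`, `continuousOn_uncurry_lerayBackward`,
`isDivFree_lerayBackward` (`LeraySelfSimilarCalculus`); `lintegral_comp_smul_fin3`,
`measurable_lerayScale`, `lerayScale_pos'`, `setLIntegral_prod_eq_setLIntegral_setLIntegral`
(`TsaiLocalEnergyScaling`); `IsLerayProfile.eq_zero_of_growth` (`TsaiProfileEndgame`);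
`parabolicCylinder(Opens)`, `isOpen_parabolicCylinder`, `IsSuitableWeakSolutionOn`
(`SuitableWeak`). `lean search 'nrs1996'` (only `NecasRuzickaSverak1996.lean`), `'lemma31'`
(only the Friedlander–Iwaniec sieve lemma), and the theorem names of this file: no earlier
rendering of NRŠ's Lemma 3.1 or of the `L³` decay in the tree (`tsai1998_corollary43`,
`TsaiLocalEnergy`, derives the same decay from the local energy hypotheses of Tsai's Theorem 2;
`TsaiLocalEnergyProofs` applies Thm. 14.4 at the top of a cylinder for Tsai's Lemma 4.2).

## References

* J. Nečas, M. Růžička, V. Šverák, *On Leray's self-similar solutions of the Navier–Stokes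
  equations*, Acta Math. 176 (1996) 283–294: §2, p. 285 (Riesz transforms, `‖P‖_q ≤ C_q‖U‖²_{2q}`);
  Proposition 2.1 (p. 284); Lemma 3.1 (p. 287); Lemma 3.2 and its proof, (3.3)–(3.6)
  (pp. 288–289); Theorem 1 (p. 291) [NecasRuzickaSverak1996].
* T.-P. Tsai, *On Leray's self-similar solutions of the Navier–Stokes equations satisfying local
  energy estimates*, Arch. Rational Mech. Anal. 143 (1998) 29–51: Lemma 2.1 (p. 34), (3.11) and
  §3.4 (p. 42), §5 (p. 48) [Tsai1998].
* P. G. Lemarié-Rieusset, *The Navier–Stokes problem in the 21st century*, CRC Press (2016),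
  Thm. 14.4 (p. 505) [LemarieRieusset2016].
* L. Caffarelli, R. Kohn, L. Nirenberg, *Partial regularity of suitable weak solutions of the
  Navier–Stokes equations*, Comm. Pure Appl. Math. 35 (1982), Proposition 1 and Corollary 1
  [CaffarelliKohnNirenberg1982].
-/

noncomputable section

open MeasureTheory Set Filter Topology Metric Function TopologicalSpace
open scoped ENNReal NNReal RealInnerProductSpace ContDiff Laplacian InnerProductSpace

namespace Literature.Analysis.FluidPDE

/-- Local notation for physical space `ℝ³ = EuclideanSpace ℝ (Fin 3)`. -/
local notation "ℝ³" => EuclideanSpace ℝ (Fin 3)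

/-! ### The Calderón–Zygmund input (named fact) -/

/-- **NRŠ 1996, Lemma 3.1 (the `L^{3/2}` pressure of an `L³` profile)** (Acta Math. 176, p. 287,
with §2, p. 285). Lemma 3.1: "Let `U ∈ L³(ℝ³)` be a weak solution of (1.3). Assume that `P` is
defined by `P = RⱼRₖ(UⱼUₖ)` … Then both `U` and `P` are smooth, `P` belongs to `L^{3/2}(ℝ³)`,
and moreover `−νΔU + aU + a(y·∇)U + (U·∇)U + ∇P = 0` in `ℝ³`" (p. 285: by the classical results
on the Riesz transforms [CZ], [St], `P = RⱼRₖ(UⱼUₖ)` satisfies `‖P‖_{L^q} ≤ C_q ‖U‖²_{L^{2q}}` and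
solves `−ΔP = ∂ⱼ∂ₖ(UⱼUₖ)` in the sense of distributions; (3.1) is proved on pp. 287–288 by
showing that the harmonic field `F = −νΔU + … + ∇P` vanishes). Rendered for the tree's pointwise
class `IsLerayProfile ν a U P` (`ν > 0`, `a > 0` as in print) with `U ∈ L³`: such a `U` is a weak
solution in `L³`, and the given `C¹` pressure `P` has, by (1.3) and (3.1), the same gradient as
the Riesz pressure `RⱼRₖ(UⱼUₖ) ∈ L^{3/2}`, hence differs from it by a constant `c` on the
connected space `ℝ³`: **`P − c ∈ L^{3/2}(ℝ³)` for some constant `c`**. Calderón–Zygmund theory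
(boundedness of `RⱼRₖ` on `L^{3/2}`) is not in Mathlib; named fact (its Liouville half is the
unweighted twin of the proved `IsLerayProfile.exists_sub_ae_eq_const` of
`TsaiSelfSimilarPressureProofs`). [cite: NecasRuzickaSverak1996, Lemma 3.1 (p. 287) with §2 p. 285] -/
def nrs1996_lemma31 : Prop :=
  ∀ {ν a : ℝ} (_hν : 0 < ν) (_ha : 0 < a) {U : ℝ³ → ℝ³} {P : ℝ³ → ℝ}
    (_hprof : IsLerayProfile ν a U P) (_hU : MemLp U 3),
    ∃ c : ℝ, MemLp (fun y => P y - c) (3 / 2 : ℝ≥0∞)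

/-! ### Lemarié-Rieusset's Theorem 14.4 for the accepted suitable class -/

/-- Backward parabolic cylinders of positive radius are connected (convex and nonempty).
[folklore] -/
theorem parabolicCylinder_isConnected {X : Type*} [NormedAddCommGroup X] [NormedSpace ℝ X]
    {r : ℝ} (hr : 0 < r) (z : ℝ × X) : IsConnected (parabolicCylinder r z) := by
  refine ⟨⟨(z.1 - r ^ 2 / 2, z.2), ?_⟩, ((convex_Ioo _ _).prod (convex_ball _ _)).isPreconnected⟩
  simp only [mem_parabolicCylinder, dist_self]
  refine ⟨⟨by nlinarith, by nlinarith⟩, hr⟩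

/-- **The one-scale ε-regularity criterion for suitable weak solutions (zero force)**
(Caffarelli–Kohn–Nirenberg 1982, Proposition 1 and Corollary 1; here from Lemarié-Rieusset 2016,
Thm. 14.4, with `q = 3`, `f = 0`, `λ = ε₀`). For every `ν > 0` there are `ε₀, C₀ > 0` such that:
if `(u, p)` is a suitable weak solution (accepted class `IsSuitableWeakSolutionOn`, force `0`) on
an open region `Q ⊆ ℝ × ℝ³`, `z₀ = (t₀, x₀)`, `0 < r₀ ≤ r₁`, the closed box
`[t₀ − r₁², t₀] × B̄_{r₁}(x₀)` lies in `Q`, and `∫∫_{Q_{r₀}(z₀)} (|u|³ + |p|^{3/2}) ≤ ε₀³ r₀²`, then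
`|u| ≤ C₀ ε₀ / r₀` a.e. on `Q_{r₀/2}(z₀)`. Proof: restrict to the cylinder `Ω = Q_{r₁}(z₀)`, on
which the local classes of the suitable solution (taken on the compact box) are the global
hypotheses `(ℋ_CKN)` of Thm. 14.4 (the localisation of `ckn_epsilon_regularity_of_exponent`).
[cite: LemarieRieusset2016, Thm. 14.4 (p. 505)] -/
theorem epsilonRegularity_of_isSuitableWeakSolutionOn (hLR : lemarieRieusset_epsilon_regularity)
    {ν : ℝ} (hν : 0 < ν) :
    ∃ ε₀ C₀ : ℝ, 0 < ε₀ ∧ 0 < C₀ ∧ ∀ (Q : Opens (ℝ × ℝ³)) (u : ℝ → ℝ³ → ℝ³) (p : ℝ → ℝ³ → ℝ),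
      IsSuitableWeakSolutionOn Q ν 0 u p →
      ∀ (z₀ : ℝ × ℝ³) (r₀ r₁ : ℝ), 0 < r₀ → r₀ ≤ r₁ →
        Icc (z₀.1 - r₁ ^ 2) z₀.1 ×ˢ closedBall z₀.2 r₁ ⊆ (Q : Set (ℝ × ℝ³)) →
        ∫⁻ w in parabolicCylinder r₀ z₀, (‖u w.1 w.2‖ₑ ^ (3 : ℕ) + ‖p w.1 w.2‖ₑ ^ (3 / 2 : ℝ)) ≤
          ENNReal.ofReal (ε₀ ^ 3 * r₀ ^ 2) →
        ∀ᵐ w ∂(volume.restrict (parabolicCylinder (r₀ / 2) z₀)), ‖u w.1 w.2‖ ≤ C₀ * ε₀ / r₀ := by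
  obtain ⟨ε₀, C₀, hε₀, hC₀, H⟩ := hLR ν 3 hν (by norm_num)
  refine ⟨ε₀, C₀, hε₀, hC₀, fun Q u p hsws z₀ r₀ r₁ hr₀ hr₀₁ hKQ hsmall => ?_⟩
  have hr₁ : 0 < r₁ := hr₀.trans_le hr₀₁
  set K : Set (ℝ × ℝ³) := Icc (z₀.1 - r₁ ^ 2) z₀.1 ×ˢ closedBall z₀.2 r₁ with hK
  have hKc : IsCompact K := isCompact_Icc.prod (isCompact_closedBall _ _)
  set Ω : Opens (ℝ × ℝ³) := parabolicCylinderOpens r₁ z₀ with hΩdef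
  have hΩ : (Ω : Set (ℝ × ℝ³)) = parabolicCylinder r₁ z₀ := rfl
  have hΩK : (Ω : Set (ℝ × ℝ³)) ⊆ K := by
    rw [hΩ]
    show Ioo (z₀.1 - r₁ ^ 2) z₀.1 ×ˢ ball z₀.2 r₁ ⊆ Icc (z₀.1 - r₁ ^ 2) z₀.1 ×ˢ closedBall z₀.2 r₁
    exact prod_mono Ioo_subset_Icc_self ball_subset_closedBall
  have hΩQ' : (Ω : Set (ℝ × ℝ³)) ⊆ (Q : Set (ℝ × ℝ³)) := hΩK.trans hKQ
  have hΩQ : Ω ≤ Q := hΩQ'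
  -- the data of the suitable weak solution, restricted to `Ω`
  obtain ⟨G, hG, hGL2, hLE⟩ := hsws.localEnergy
  obtain ⟨Cu, hCu⟩ := hsws.energyClass K hKQ hKc
  have hpK := hsws.pressure K hKQ hKc
  have hdist : IsDistributionalNSSolutionOn Ω ν 0 u p := hsws.distributional.of_le hΩQ
  have hE : ∃ C : ℝ≥0, ∀ᵐ t : ℝ,
      ∫⁻ x, (Ω : Set (ℝ × ℝ³)).indicator (fun z : ℝ × ℝ³ => ‖u z.1 z.2‖ₑ ^ 2) (t, x) ≤ C := by
    refine ⟨Cu, ?_⟩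
    filter_upwards [hCu] with t ht
    refine (lintegral_mono fun x => ?_).trans ht
    exact indicator_le_indicator_of_subset hΩK (fun _ => zero_le) _
  have hGΩ : ∫⁻ w in (Ω : Set (ℝ × ℝ³)), ENNReal.ofReal (frobeniusNormSq (G w.1 w.2)) < ⊤ :=
    (lintegral_mono_set hΩK).trans_lt (hGL2 K hKQ hKc)
  have hpΩ : ∫⁻ w in (Ω : Set (ℝ × ℝ³)), ‖p w.1 w.2‖ₑ ^ (3 / 2 : ℝ) < ⊤ :=
    (lintegral_mono_set hΩK).trans_lt hpK
  have hfΩ : MemLp (uncurry (0 : ℝ → ℝ³ → ℝ³)) (ENNReal.ofReal 3)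
      (volume.restrict (Ω : Set (ℝ × ℝ³))) :=
    (MemLp.zero : MemLp (0 : ℝ × ℝ³ → ℝ³) (ENNReal.ofReal 3)
      (volume.restrict (Ω : Set (ℝ × ℝ³))))
  have hLEΩ : ∀ φ : ℝ → ℝ³ → ℝ, IsSpaceTimeTestOn Ω φ → (∀ t x, 0 ≤ φ t x) →
      2 * ν * ∫ t, ∫ x, frobeniusNormSq (G t x) * φ t x ≤
        ∫ t, ∫ x, (‖u t x‖ ^ 2 * (timeDeriv φ t x + ν * Δ (φ t) x) +
          (‖u t x‖ ^ 2 + 2 * p t x) * ⟪u t x, gradient (φ t) x⟫ +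
          2 * ⟪(0 : ℝ → ℝ³ → ℝ³) t x, u t x⟫ * φ t x) :=
    fun φ hφ hφ0 => hLE φ (hφ.mono hΩQ) hφ0
  have hcyl : parabolicCylinder r₀ z₀ ⊆ (Ω : Set (ℝ × ℝ³)) := by
    rw [hΩ]
    show Ioo (z₀.1 - r₀ ^ 2) z₀.1 ×ˢ ball z₀.2 r₀ ⊆ Ioo (z₀.1 - r₁ ^ 2) z₀.1 ×ˢ ball z₀.2 r₁
    have hsq : r₀ ^ 2 ≤ r₁ ^ 2 := pow_le_pow_left₀ hr₀.le hr₀₁ 2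
    exact prod_mono (Ioo_subset_Ioo (by linarith) le_rfl) (ball_subset_ball hr₀₁)
  have hforce : ∫⁻ w in parabolicCylinder r₀ z₀, ‖(0 : ℝ → ℝ³ → ℝ³) w.1 w.2‖ₑ ^ (3 : ℝ) ≤
      ENNReal.ofReal (ε₀ ^ ((2 : ℝ) * 3) * r₀ ^ ((5 : ℝ) - 3 * 3)) := by
    simp [ENNReal.zero_rpow_of_pos (by norm_num : (0 : ℝ) < 3)]
  exact H Ω 0 u p G (by rw [hΩ]; exact parabolicCylinder_isConnected hr₁ z₀) hE (hG.mono hΩQ)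
    hGΩ hpΩ hfΩ hdist hLEΩ z₀ r₀ ε₀ hr₀ hcyl hε₀.le le_rfl hsmall hforce

/-! ### From an a.e. bound to a pointwise bound for continuous fields -/

/-- If `u` is jointly continuous on an open set `W ⊆ ℝ × ℝ³` and `‖u‖ ≤ M` a.e. on an open
`V ⊆ W`, then `‖u‖ ≤ M` everywhere on `V` (an open null set is empty). [folklore] -/
theorem forall_norm_le_of_ae_restrict {u : ℝ → ℝ³ → ℝ³} {W V : Set (ℝ × ℝ³)}
    (hu : ContinuousOn (uncurry u) W) (hV : IsOpen V) (hVW : V ⊆ W) {M : ℝ}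
    (h : ∀ᵐ w ∂(volume.restrict V), ‖u w.1 w.2‖ ≤ M) : ∀ w ∈ V, ‖u w.1 w.2‖ ≤ M := by
  have hopen : IsOpen (V ∩ (uncurry u) ⁻¹' {v | M < ‖v‖}) :=
    (hu.mono hVW).isOpen_inter_preimage hV (isOpen_lt continuous_const continuous_norm)
  have hae : ∀ᵐ w ∂(volume : Measure (ℝ × ℝ³)), w ∉ V ∩ (uncurry u) ⁻¹' {v | M < ‖v‖} := by
    rw [ae_restrict_iff' hV.measurableSet] at h
    filter_upwards [h] with w hw hmem
    exact (not_lt.2 (hw hmem.1)) hmem.2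
  have hnull : volume (V ∩ (uncurry u) ⁻¹' {v | M < ‖v‖}) = 0 := by
    rw [ae_iff] at hae
    simpa only [not_not, setOf_mem_eq] using hae
  intro w hwV
  by_contra hlt
  have hmem : w ∈ V ∩ (uncurry u) ⁻¹' {v | M < ‖v‖} := ⟨hwV, not_le.1 hlt⟩
  exact (hopen.measure_pos volume ⟨w, hmem⟩).ne' hnull

/-! ### Tails of finite integrals -/

/-- If `∫ g < ⊤` on `ℝ³` then `∫_{|y| ≥ ρ} g → 0` as `ρ → ∞` (dominated convergence).
[folklore] -/
theorem tendsto_setLIntegral_norm_ge_atTop {g : ℝ³ → ℝ≥0∞} (hgm : Measurable g)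
    (hg : ∫⁻ y, g y ≠ ⊤) :
    Tendsto (fun ρ : ℝ => ∫⁻ y in {y : ℝ³ | ρ ≤ ‖y‖}, g y) atTop (𝓝 0) := by
  have hmeas : ∀ ρ : ℝ, MeasurableSet {y : ℝ³ | ρ ≤ ‖y‖} := fun ρ =>
    (isClosed_le continuous_const continuous_norm).measurableSet
  have hlim : ∀ᵐ y ∂(volume : Measure ℝ³),
      Tendsto (fun ρ : ℝ => ({y : ℝ³ | ρ ≤ ‖y‖}).indicator g y) atTop (𝓝 0) := by
    refine Eventually.of_forall fun y => ?_
    refine tendsto_const_nhds.congr' ?_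
    filter_upwards [eventually_gt_atTop ‖y‖] with ρ hρ
    rw [indicator_of_notMem]
    simpa only [mem_setOf_eq, not_le] using hρ
  have h := tendsto_lintegral_filter_of_dominated_convergence (μ := (volume : Measure ℝ³))
    (l := atTop) (F := fun ρ y => ({y : ℝ³ | ρ ≤ ‖y‖}).indicator g y) (f := fun _ => 0) g
    (Eventually.of_forall fun ρ => hgm.indicator (hmeas ρ))
    (Eventually.of_forall fun ρ => Eventually.of_forall fun y => indicator_le_self _ _ y)
    hg hlim
  simpa only [lintegral_indicator (hmeas _), lintegral_zero] using h

/-! ### The self-similar fields: measurability and the scale-invariant slice integrals -/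

section Slices

variable {U : ℝ³ → ℝ³} {P : ℝ³ → ℝ} {a T : ℝ}

/-- Joint measurability of Leray's backward field `(t, x) ↦ λ(t) U(λ(t) x)` (junk included).
[folklore] -/
theorem measurable_uncurry_lerayBackward (hU : Measurable U) (a T : ℝ) :
    Measurable (uncurry (lerayBackward a T U)) := by
  have hs : Measurable fun q : ℝ × ℝ³ => (Real.sqrt (2 * a * (T - q.1)))⁻¹ :=
    (measurable_lerayScale a T).comp measurable_fst
  have h1 : Measurable fun q : ℝ × ℝ³ => (Real.sqrt (2 * a * (T - q.1)))⁻¹ • q.2 :=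
    hs.smul measurable_snd
  have h2 : Measurable fun q : ℝ × ℝ³ =>
      (Real.sqrt (2 * a * (T - q.1)))⁻¹ • U ((Real.sqrt (2 * a * (T - q.1)))⁻¹ • q.2) :=
    hs.smul (hU.comp h1)
  exact h2

/-- Joint measurability of the self-similar pressure `(t, x) ↦ λ(t)² (P(λ(t) x) − c)`.
[folklore] -/
theorem measurable_uncurry_lerayPressure (hP : Measurable P) (a T c : ℝ) :
    Measurable (uncurry fun (t : ℝ) (x : ℝ³) => ((Real.sqrt (2 * a * (T - t)))⁻¹) ^ 2 *
      (P ((Real.sqrt (2 * a * (T - t)))⁻¹ • x) - c)) := by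
  have hs : Measurable fun q : ℝ × ℝ³ => (Real.sqrt (2 * a * (T - q.1)))⁻¹ :=
    (measurable_lerayScale a T).comp measurable_fst
  have h1 : Measurable fun q : ℝ × ℝ³ => (Real.sqrt (2 * a * (T - q.1)))⁻¹ • q.2 :=
    hs.smul measurable_snd
  have h2 : Measurable fun q : ℝ × ℝ³ =>
      ((Real.sqrt (2 * a * (T - q.1)))⁻¹) ^ 2 * (P ((Real.sqrt (2 * a * (T - q.1)))⁻¹ • q.2) - c) :=
    (hs.pow_const 2).mul ((hP.comp h1).sub_const c)
  exact h2

/-- Points `x` of a ball `B_r(x₀)` with `|x₀| = 1`, `r ≤ 1/2` have `|x| ≥ 1/2`, so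
`|L x| ≥ ρ` whenever `0 ≤ L` and `2ρ ≤ L` (the scaled ball `λ B_r(x₀)` lies in `{|y| ≥ λ/2}`).
[folklore] -/
theorem le_norm_smul_of_mem_ball {x₀ x : ℝ³} (hx₀ : ‖x₀‖ = 1) {r ρ L : ℝ} (hr : r ≤ 1 / 2)
    (hx : x ∈ ball x₀ r) (hL : 0 ≤ L) (hρ : 2 * ρ ≤ L) : ρ ≤ ‖L • x‖ := by
  rw [mem_ball_iff_norm] at hx
  have h1 : 1 / 2 ≤ ‖x‖ := by
    have := norm_sub_norm_le x₀ x
    rw [norm_sub_rev] at this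
    linarith
  rw [norm_smul, Real.norm_of_nonneg hL]
  nlinarith

/-- **(3.5), velocity slice.** For `t < T` with `λ(t) ≥ 2ρ`, `|x₀| = 1` and `r ≤ 1/2`:
`∫_{B_r(x₀)} |u(t, x)|³ dx ≤ ∫_{|y| ≥ ρ} |U(y)|³ dy` for `u = λ U(λ ·)` (the substitution `y = λx`:
`|u|³ dx = |U(y)|³ dy`, and `λ B_r(x₀) ⊆ {|y| ≥ λ/2}`). [cite: NecasRuzickaSverak1996, (3.5) p. 288] -/
theorem setLIntegral_ball_enorm_lerayBackward_le (ha : 0 < a) {t ρ r : ℝ}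
    (ht : t < T) {x₀ : ℝ³} (hx₀ : ‖x₀‖ = 1) (hr : r ≤ 1 / 2)
    (hρ : 2 * ρ ≤ (Real.sqrt (2 * a * (T - t)))⁻¹) :
    ∫⁻ x in ball x₀ r, ‖lerayBackward a T U t x‖ₑ ^ (3 : ℕ) ≤
      ∫⁻ y in {y : ℝ³ | ρ ≤ ‖y‖}, ‖U y‖ₑ ^ (3 : ℕ) := by
  set L := (Real.sqrt (2 * a * (T - t)))⁻¹ with hL
  have hL0 : 0 < L := lerayScale_pos' ha ht
  set A : Set ℝ³ := {y | ρ ≤ ‖y‖} with hA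
  have hAm : MeasurableSet A := (isClosed_le continuous_const continuous_norm).measurableSet
  set g : ℝ³ → ℝ≥0∞ := fun y => ‖U y‖ₑ ^ (3 : ℕ) with hg
  have hpt : ∀ x, ‖lerayBackward a T U t x‖ₑ ^ (3 : ℕ) = ENNReal.ofReal (L ^ 3) * g (L • x) := by
    intro x
    rw [lerayBackward_apply, ← hL, enorm_smul, mul_pow, Real.enorm_eq_ofReal hL0.le,
      ← ENNReal.ofReal_pow hL0.le]
  calc ∫⁻ x in ball x₀ r, ‖lerayBackward a T U t x‖ₑ ^ (3 : ℕ)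
      = ∫⁻ x, (ball x₀ r).indicator (fun x => ENNReal.ofReal (L ^ 3) * g (L • x)) x := by
        rw [← lintegral_indicator measurableSet_ball]
        simp_rw [hpt]
    _ ≤ ∫⁻ x, ENNReal.ofReal (L ^ 3) * A.indicator g (L • x) := by
        refine lintegral_mono fun x => ?_
        by_cases hx : x ∈ ball x₀ r
        · rw [indicator_of_mem hx,
            indicator_of_mem (show L • x ∈ A from le_norm_smul_of_mem_ball hx₀ hr hx hL0.le hρ)]
        · rw [indicator_of_notMem hx]
          exact zero_le
    _ = ENNReal.ofReal (L ^ 3) * (ENNReal.ofReal ((L ^ 3)⁻¹) * ∫⁻ y, A.indicator g y) := by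
        rw [lintegral_const_mul' _ _ ENNReal.ofReal_ne_top,
          lintegral_comp_smul_fin3 (fun y => A.indicator g y) hL0]
    _ = ∫⁻ y in A, g y := by
        rw [← mul_assoc, ← ENNReal.ofReal_mul (by positivity),
          mul_inv_cancel₀ (by positivity), ENNReal.ofReal_one, one_mul, lintegral_indicator hAm]

/-- **(3.5), pressure slice.** For `t < T` with `λ(t) ≥ 2ρ`, `|x₀| = 1` and `r ≤ 1/2`:
`∫_{B_r(x₀)} |λ²(P(λx) − c)|^{3/2} dx ≤ ∫_{|y| ≥ ρ} |P − c|^{3/2} dy`. [cite: NecasRuzickaSverak1996, (3.5) p. 288] -/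
theorem setLIntegral_ball_enorm_lerayPressure_le (ha : 0 < a) (c : ℝ)
    {t ρ r : ℝ} (ht : t < T) {x₀ : ℝ³} (hx₀ : ‖x₀‖ = 1) (hr : r ≤ 1 / 2)
    (hρ : 2 * ρ ≤ (Real.sqrt (2 * a * (T - t)))⁻¹) :
    ∫⁻ x in ball x₀ r, ‖((Real.sqrt (2 * a * (T - t)))⁻¹) ^ 2 *
        (P ((Real.sqrt (2 * a * (T - t)))⁻¹ • x) - c)‖ₑ ^ (3 / 2 : ℝ) ≤
      ∫⁻ y in {y : ℝ³ | ρ ≤ ‖y‖}, ‖P y - c‖ₑ ^ (3 / 2 : ℝ) := by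
  set L := (Real.sqrt (2 * a * (T - t)))⁻¹ with hL
  have hL0 : 0 < L := lerayScale_pos' ha ht
  set A : Set ℝ³ := {y | ρ ≤ ‖y‖} with hA
  have hAm : MeasurableSet A := (isClosed_le continuous_const continuous_norm).measurableSet
  set g : ℝ³ → ℝ≥0∞ := fun y => ‖P y - c‖ₑ ^ (3 / 2 : ℝ) with hg
  have hL3 : (L ^ 2) ^ (3 / 2 : ℝ) = L ^ 3 := by
    rw [← Real.rpow_natCast L 2, ← Real.rpow_mul hL0.le, ← Real.rpow_natCast L 3]
    norm_num
  have hpt : ∀ x, ‖L ^ 2 * (P (L • x) - c)‖ₑ ^ (3 / 2 : ℝ) = ENNReal.ofReal (L ^ 3) * g (L • x) := by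
    intro x
    rw [enorm_mul, ENNReal.mul_rpow_of_nonneg _ _ (by norm_num : (0 : ℝ) ≤ 3 / 2),
      Real.enorm_eq_ofReal (sq_nonneg L), ENNReal.ofReal_rpow_of_nonneg (sq_nonneg L)
        (by norm_num : (0 : ℝ) ≤ 3 / 2), hL3]
  calc ∫⁻ x in ball x₀ r, ‖L ^ 2 * (P (L • x) - c)‖ₑ ^ (3 / 2 : ℝ)
      = ∫⁻ x, (ball x₀ r).indicator (fun x => ENNReal.ofReal (L ^ 3) * g (L • x)) x := by
        rw [← lintegral_indicator measurableSet_ball]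
        simp_rw [hpt]
    _ ≤ ∫⁻ x, ENNReal.ofReal (L ^ 3) * A.indicator g (L • x) := by
        refine lintegral_mono fun x => ?_
        by_cases hx : x ∈ ball x₀ r
        · rw [indicator_of_mem hx,
            indicator_of_mem (show L • x ∈ A from le_norm_smul_of_mem_ball hx₀ hr hx hL0.le hρ)]
        · rw [indicator_of_notMem hx]
          exact zero_le
    _ = ENNReal.ofReal (L ^ 3) * (ENNReal.ofReal ((L ^ 3)⁻¹) * ∫⁻ y, A.indicator g y) := by
        rw [lintegral_const_mul' _ _ ENNReal.ofReal_ne_top,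
          lintegral_comp_smul_fin3 (fun y => A.indicator g y) hL0]
    _ = ∫⁻ y in A, g y := by
        rw [← mul_assoc, ← ENNReal.ofReal_mul (by positivity),
          mul_inv_cancel₀ (by positivity), ENNReal.ofReal_one, one_mul, lintegral_indicator hAm]

/-- **Late times have large scale factors**: for `t < T` with `T − t ≤ (8aρ²)⁻¹` (`a, ρ > 0`),
`λ(t) = (2a(T − t))^{-1/2} ≥ 2ρ`. [folklore] -/
theorem two_mul_le_lerayScale (ha : 0 < a) {ρ t : ℝ} (hρ : 0 < ρ) (ht : t < T)
    (h : T - t ≤ 1 / (8 * a * ρ ^ 2)) : 2 * ρ ≤ (Real.sqrt (2 * a * (T - t)))⁻¹ := by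
  have hs : 0 < 2 * a * (T - t) := mul_pos (mul_pos two_pos ha) (sub_pos.2 ht)
  have hle : 2 * a * (T - t) ≤ (1 / (2 * ρ)) ^ 2 := by
    calc 2 * a * (T - t) ≤ 2 * a * (1 / (8 * a * ρ ^ 2)) := by gcongr
      _ = (1 / (2 * ρ)) ^ 2 := by field_simp; ring
  have hsqrt : Real.sqrt (2 * a * (T - t)) ≤ 1 / (2 * ρ) := by
    calc Real.sqrt (2 * a * (T - t)) ≤ Real.sqrt ((1 / (2 * ρ)) ^ 2) := Real.sqrt_le_sqrt hle
      _ = 1 / (2 * ρ) := Real.sqrt_sq (by positivity)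
  calc 2 * ρ = (1 / (2 * ρ))⁻¹ := by rw [one_div, inv_inv]
    _ ≤ (Real.sqrt (2 * a * (T - t)))⁻¹ := inv_anti₀ (Real.sqrt_pos.2 hs) hsqrt

/-- **(3.5), both slices.** For `t < T` with `λ(t) ≥ 2ρ`, `|x₀| = 1`, `r ≤ 1/2` and tails
`∫_{|y| ≥ ρ} |U|³ ≤ η`, `∫_{|y| ≥ ρ} |P − c|^{3/2} ≤ η`:
`∫_{B_r(x₀)} (|u(t)|³ + |p(t)|^{3/2}) ≤ 2η` for `u = λU(λ·)`, `p = λ²(P(λ·) − c)`.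
[cite: NecasRuzickaSverak1996, (3.5) p. 288] -/
theorem setLIntegral_ball_selfSimilar_le (hUm : Measurable U)
    (ha : 0 < a) (c : ℝ) {t ρ r : ℝ} (ht : t < T) {x₀ : ℝ³} (hx₀ : ‖x₀‖ = 1) (hr : r ≤ 1 / 2)
    (hρ : 2 * ρ ≤ (Real.sqrt (2 * a * (T - t)))⁻¹) {η : ℝ≥0∞}
    (hUη : ∫⁻ y in {y : ℝ³ | ρ ≤ ‖y‖}, ‖U y‖ₑ ^ (3 : ℕ) ≤ η)
    (hPη : ∫⁻ y in {y : ℝ³ | ρ ≤ ‖y‖}, ‖P y - c‖ₑ ^ (3 / 2 : ℝ) ≤ η) :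
    ∫⁻ x in ball x₀ r, (‖lerayBackward a T U t x‖ₑ ^ (3 : ℕ) +
        ‖((Real.sqrt (2 * a * (T - t)))⁻¹) ^ 2 *
          (P ((Real.sqrt (2 * a * (T - t)))⁻¹ • x) - c)‖ₑ ^ (3 / 2 : ℝ)) ≤ 2 * η := by
  have hum : Measurable fun x : ℝ³ => ‖lerayBackward a T U t x‖ₑ ^ (3 : ℕ) := by
    have h1 : Measurable fun x : ℝ³ => lerayBackward a T U t x := by
      show Measurable fun x : ℝ³ => (Real.sqrt (2 * a * (T - t)))⁻¹ •
        U ((Real.sqrt (2 * a * (T - t)))⁻¹ • x)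
      exact (hUm.comp (measurable_const_smul ((Real.sqrt (2 * a * (T - t)))⁻¹))).const_smul
        ((Real.sqrt (2 * a * (T - t)))⁻¹)
    exact h1.enorm.pow_const 3
  rw [lintegral_add_left hum]
  refine le_trans (add_le_add
    ((setLIntegral_ball_enorm_lerayBackward_le ha ht hx₀ hr hρ).trans hUη)
    ((setLIntegral_ball_enorm_lerayPressure_le ha c ht hx₀ hr hρ).trans hPη)) (le_of_eq ?_)
  exact (two_mul η).symm

/-- **(3.5) on a parabolic cylinder.** If `t₀ ≤ T`, `r₀ ≤ 1/2`, `|x₀| = 1`, every time of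
`(t₀ − r₀², t₀)` has scale factor `λ ≥ 2ρ`, and the tails `∫_{|y| ≥ ρ} |U|³`,
`∫_{|y| ≥ ρ} |P − c|^{3/2}` are at most `η`, then
`∫∫_{Q_{r₀}(t₀, x₀)} (|u|³ + |p|^{3/2}) ≤ 2η r₀²` for the self-similar pair
`u = λU(λ·)`, `p = λ²(P(λ·) − c)` (Tonelli and the two slice bounds). [cite: NecasRuzickaSverak1996, (3.5) pp. 288–289] -/
theorem lintegral_parabolicCylinder_selfSimilar_le (hUm : Measurable U) (hPm : Measurable P)
    (ha : 0 < a) (c : ℝ) {ρ r₀ t₀ : ℝ} {x₀ : ℝ³} (hx₀ : ‖x₀‖ = 1) (hr : r₀ ≤ 1 / 2)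
    (ht₀ : t₀ ≤ T) (hlow : ∀ t ∈ Ioo (t₀ - r₀ ^ 2) t₀, 2 * ρ ≤ (Real.sqrt (2 * a * (T - t)))⁻¹)
    {η : ℝ≥0∞} (hUη : ∫⁻ y in {y : ℝ³ | ρ ≤ ‖y‖}, ‖U y‖ₑ ^ (3 : ℕ) ≤ η)
    (hPη : ∫⁻ y in {y : ℝ³ | ρ ≤ ‖y‖}, ‖P y - c‖ₑ ^ (3 / 2 : ℝ) ≤ η) :
    ∫⁻ w in parabolicCylinder r₀ (t₀, x₀), (‖lerayBackward a T U w.1 w.2‖ₑ ^ (3 : ℕ) +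
        ‖((Real.sqrt (2 * a * (T - w.1)))⁻¹) ^ 2 *
          (P ((Real.sqrt (2 * a * (T - w.1)))⁻¹ • w.2) - c)‖ₑ ^ (3 / 2 : ℝ)) ≤
      2 * η * ENNReal.ofReal (r₀ ^ 2) := by
  have hFm : Measurable fun w : ℝ × ℝ³ => ‖lerayBackward a T U w.1 w.2‖ₑ ^ (3 : ℕ) +
      ‖((Real.sqrt (2 * a * (T - w.1)))⁻¹) ^ 2 *
        (P ((Real.sqrt (2 * a * (T - w.1)))⁻¹ • w.2) - c)‖ₑ ^ (3 / 2 : ℝ) :=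
    ((measurable_uncurry_lerayBackward hUm a T).enorm.pow_const 3).add
      ((measurable_uncurry_lerayPressure hPm a T c).enorm.pow_const _)
  rw [show parabolicCylinder r₀ (t₀, x₀) = Ioo (t₀ - r₀ ^ 2) t₀ ×ˢ ball x₀ r₀ from rfl,
    setLIntegral_prod_eq_setLIntegral_setLIntegral _ hFm.aemeasurable]
  calc ∫⁻ t in Ioo (t₀ - r₀ ^ 2) t₀, ∫⁻ x in ball x₀ r₀, (‖lerayBackward a T U t x‖ₑ ^ (3 : ℕ) +
        ‖((Real.sqrt (2 * a * (T - t)))⁻¹) ^ 2 *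
          (P ((Real.sqrt (2 * a * (T - t)))⁻¹ • x) - c)‖ₑ ^ (3 / 2 : ℝ))
      ≤ ∫⁻ _ in Ioo (t₀ - r₀ ^ 2) t₀, 2 * η := by
        refine setLIntegral_mono' measurableSet_Ioo fun t ht => ?_
        exact setLIntegral_ball_selfSimilar_le hUm ha c (ht.2.trans_le ht₀) hx₀ hr
          (hlow t ht) hUη hPη
    _ = 2 * η * ENNReal.ofReal (r₀ ^ 2) := by
        rw [setLIntegral_const, Real.volume_Ioo, sub_sub_cancel]

end Slices

/-! ### The decay of `L³` profiles -/

/-- Finiteness of `∫ |U|³` for `U ∈ L³` (natural-number power form). [folklore] -/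
theorem lintegral_enorm_pow_three_ne_top {U : ℝ³ → ℝ³} (hU : MemLp U 3 volume) :
    ∫⁻ y, ‖U y‖ₑ ^ (3 : ℕ) ≠ ⊤ := by
  have h := hU.2
  rw [eLpNorm_lt_top_iff_lintegral_rpow_enorm_lt_top (by norm_num) (by simp)] at h
  have h' : ∫⁻ y, ‖U y‖ₑ ^ (3 : ℕ) = ∫⁻ y, ‖U y‖ₑ ^ ((3 : ℝ≥0∞).toReal) := by
    refine lintegral_congr fun y => ?_
    rw [ENNReal.toReal_ofNat, ← ENNReal.rpow_natCast]
    norm_num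
  rw [h']
  exact h.ne

/-- Finiteness of `∫ |P − c|^{3/2}` for `P − c ∈ L^{3/2}`. [folklore] -/
theorem lintegral_enorm_rpow_threeHalves_ne_top {g : ℝ³ → ℝ} (hg : MemLp g (3 / 2 : ℝ≥0∞) volume) :
    ∫⁻ y, ‖g y‖ₑ ^ (3 / 2 : ℝ) ≠ ⊤ := by
  have h := hg.2
  have h0 : (3 / 2 : ℝ≥0∞) ≠ 0 := by norm_num
  have htop : (3 / 2 : ℝ≥0∞) ≠ ⊤ := by
    rw [Ne, ENNReal.div_eq_top]
    norm_num
  rw [eLpNorm_lt_top_iff_lintegral_rpow_enorm_lt_top h0 htop] at h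
  have h32 : (3 / 2 : ℝ≥0∞).toReal = 3 / 2 := by
    rw [ENNReal.toReal_div, ENNReal.toReal_ofNat, ENNReal.toReal_ofNat]
  rw [h32] at h
  exact h.ne

/-- **NRŠ 1996, (3.5)–(3.6) with `k = 0` and (3.3): `L³` profiles decay like `|y|⁻¹`, from the
conclusion of the one-scale criterion** (Acta Math. 176, pp. 288–289; Tsai 1998, (3.11) for
`q = 3`). Let `ν > 0`, `a > 0`, let `(U, P)` be a Leray profile (`IsLerayProfile ν a U P`: `U ∈ C²`,
`P ∈ C¹`, (1.3) pointwise) with `U ∈ L³(ℝ³)`, and assume the pressure is normalised in `L^{3/2}`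
up to a constant, `P − c ∈ L^{3/2}(ℝ³)` (NRŠ Lemma 3.1, the tree's `nrs1996_lemma31`). Assume the
*conclusion* of the one-scale ε-regularity criterion (NRŠ's Proposition 2.1 for `k = 0`) for the
accepted local class at viscosity `ν`: constants `ε₀ > 0`, `C₀` such that every suitable weak
solution `(u, p)` (zero force) on a region containing the closed box `[t₀ − r₁², t₀] × B̄_{r₁}(x₀)`,
`0 < r₀ ≤ r₁`, with `∫∫_{Q_{r₀}(z₀)} (|u|³ + |p|^{3/2}) ≤ ε₀³ r₀²` satisfies `|u| ≤ C₀ ε₀ / r₀` a.e. on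
`Q_{r₀/2}(z₀)` (hypothesis `H`; supplied by `epsilonRegularity_of_isSuitableWeakSolutionOn` from
Lemarié-Rieusset's Thm. 14.4, or by any other rendering of Caffarelli–Kohn–Nirenberg's
Proposition 1). Then there are `C, R` with `|y| |U(y)| ≤ C` for all `|y| ≥ R` (the sign of `ν` is
not used in this step). See the module
docstring for the proof (suitability of the self-similar pair below the blow-up time, the
scale-invariant smallness (3.5) on late cylinders around `(t₀, x₀)`, `|x₀| = 1`, the bound (3.6)
`|u| ≤ C₀ε₀/r₀`, and the rescaling (3.3) at the time where `λ(t) = |y|`). [cite: NecasRuzickaSverak1996, Lemma 3.2 proof (3.3)–(3.6) pp. 288–289] -/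
theorem IsLerayProfile.exists_forall_norm_mul_norm_le_of_oneScale
    {ν a : ℝ} (ha : 0 < a) {ε₀ C₀ : ℝ} (hε₀ : 0 < ε₀)
    (H : ∀ (Q : Opens (ℝ × ℝ³)) (u : ℝ → ℝ³ → ℝ³) (p : ℝ → ℝ³ → ℝ),
      IsSuitableWeakSolutionOn Q ν 0 u p →
      ∀ (z₀ : ℝ × ℝ³) (r₀ r₁ : ℝ), 0 < r₀ → r₀ ≤ r₁ →
        Icc (z₀.1 - r₁ ^ 2) z₀.1 ×ˢ closedBall z₀.2 r₁ ⊆ (Q : Set (ℝ × ℝ³)) →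
        ∫⁻ w in parabolicCylinder r₀ z₀, (‖u w.1 w.2‖ₑ ^ (3 : ℕ) + ‖p w.1 w.2‖ₑ ^ (3 / 2 : ℝ)) ≤
          ENNReal.ofReal (ε₀ ^ 3 * r₀ ^ 2) →
        ∀ᵐ w ∂(volume.restrict (parabolicCylinder (r₀ / 2) z₀)), ‖u w.1 w.2‖ ≤ C₀ * ε₀ / r₀)
    {U : ℝ³ → ℝ³} {P : ℝ³ → ℝ} (h : IsLerayProfile ν a U P)
    (hU3 : MemLp U 3 volume) {c : ℝ} (hPc : MemLp (fun y => P y - c) (3 / 2 : ℝ≥0∞) volume) :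
    ∃ C R : ℝ, ∀ y, R ≤ ‖y‖ → ‖y‖ * ‖U y‖ ≤ C := by
  have hUc : Continuous U := h.contDiff_velocity.continuous
  have hUm : Measurable U := hUc.measurable
  have hPm : Measurable P := h.contDiff_pressure.continuous.measurable
  -- ## the tails of `∫ |U|³` and `∫ |P - c|^{3/2}`
  set η : ℝ≥0∞ := ENNReal.ofReal (ε₀ ^ 3 / 2) with hη
  have hη0 : 0 < η := ENNReal.ofReal_pos.2 (by positivity)
  have h2η : 2 * η = ENNReal.ofReal (ε₀ ^ 3) := by
    rw [hη, ← ENNReal.ofReal_ofNat, ← ENNReal.ofReal_mul zero_le_two]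
    congr 1
    ring
  have hTU := tendsto_setLIntegral_norm_ge_atTop (hUm.enorm.pow_const 3)
    (lintegral_enorm_pow_three_ne_top hU3)
  have hTP := tendsto_setLIntegral_norm_ge_atTop
    ((hPm.sub_const c).enorm.pow_const (3 / 2 : ℝ)) (lintegral_enorm_rpow_threeHalves_ne_top hPc)
  obtain ⟨ρ, hρ1, hUη, hPη⟩ := ((eventually_ge_atTop (1 : ℝ)).and
    (((tendsto_order.1 hTU).2 η hη0).and ((tendsto_order.1 hTP).2 η hη0))).exists
  have hρ : 0 < ρ := one_pos.trans_le hρ1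
  -- ## the scales: `δ` (late times), `r₀` (radius of the cylinders), `δ'`
  set δ : ℝ := 1 / (8 * a * ρ ^ 2) with hδ
  have hδ0 : 0 < δ := by positivity
  set r₀ : ℝ := min (1 / 2) (Real.sqrt (δ / 2)) with hr₀
  have hr₀0 : 0 < r₀ := lt_min (by norm_num) (Real.sqrt_pos.2 (by positivity))
  have hr₀h : r₀ ≤ 1 / 2 := min_le_left _ _
  have hr₀δ : r₀ ^ 2 ≤ δ / 2 := by
    calc r₀ ^ 2 ≤ (Real.sqrt (δ / 2)) ^ 2 := pow_le_pow_left₀ hr₀0.le (min_le_right _ _) 2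
      _ = δ / 2 := Real.sq_sqrt (by positivity)
  set δ' : ℝ := min δ (r₀ ^ 2 / 2) with hδ'
  have hδ'0 : 0 < δ' := lt_min hδ0 (by positivity)
  set M : ℝ := C₀ * ε₀ / r₀ with hM
  -- ## the self-similar pair is a suitable weak solution below an (arbitrary) blow-up time `T`
  obtain ⟨T, -⟩ : ∃ T : ℝ, True := ⟨0, trivial⟩
  set u : ℝ → ℝ³ → ℝ³ := lerayBackward a T U with hu
  set p : ℝ → ℝ³ → ℝ := fun t x => ((Real.sqrt (2 * a * (T - t)))⁻¹) ^ 2 *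
    (P ((Real.sqrt (2 * a * (T - t)))⁻¹ • x) - c) with hp
  set W : Opens (ℝ × ℝ³) := ⟨Iio T ×ˢ univ, isOpen_Iio.prod isOpen_univ⟩ with hWdef
  have hW : (W : Set (ℝ × ℝ³)) = Iio T ×ˢ univ := rfl
  have hf0 : uncurry (0 : ℝ → ℝ³ → ℝ³) = fun _ => 0 := rfl
  have hsws : IsSuitableWeakSolutionOn W ν 0 u p := by
    refine isSuitableWeakSolutionOn_of_contDiffOn (S := Iio T) isOpen_Iio (by rw [hW])
      (contDiffOn_uncurry_lerayBackward ha h.contDiff_velocity T)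
      (contDiffOn_uncurry_lerayBackwardPressure_sub ha h.contDiff_pressure T c)
      (by rw [hf0]; exact continuousOn_const) (fun t ht x => ?_) (fun t _ => ?_)
    · exact h.momentum_lerayBackward ha ht c x
    · exact isDivFree_lerayBackward h.divFree a T t
  have hucont : ContinuousOn (uncurry u) (W : Set (ℝ × ℝ³)) :=
    continuousOn_uncurry_lerayBackward ha hUc T
  -- ## the bound `|u(t, x₀)| ≤ M` for `|x₀| = 1` and `T - δ' < t < T`
  have hbound : ∀ x₀ : ℝ³, ‖x₀‖ = 1 → ∀ t : ℝ, T - δ' < t → t < T → ‖u t x₀‖ ≤ M := by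
    intro x₀ hx₀ t ht1 ht2
    set t₀ : ℝ := (t + T) / 2 with ht₀
    have ht₀T : t₀ < T := by rw [ht₀]; linarith
    have htt₀ : t < t₀ := by rw [ht₀]; linarith
    have hgap : t₀ - (r₀ / 2) ^ 2 < t := by
      have : δ' ≤ r₀ ^ 2 / 2 := min_le_right _ _
      rw [ht₀]; nlinarith
    -- the closed box around the cylinder lies below the blow-up time
    have hbox : Icc ((t₀, x₀).1 - (1 : ℝ) ^ 2) (t₀, x₀).1 ×ˢ closedBall (t₀, x₀).2 1 ⊆
        (W : Set (ℝ × ℝ³)) := by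
      rw [hW]
      rintro ⟨s, z⟩ ⟨hs, -⟩
      exact ⟨lt_of_le_of_lt hs.2 ht₀T, mem_univ _⟩
    -- the smallness (3.5) on `Q_{r₀}(t₀, x₀)`
    have hlow : ∀ s ∈ Ioo (t₀ - r₀ ^ 2) t₀, 2 * ρ ≤ (Real.sqrt (2 * a * (T - s)))⁻¹ := by
      intro s hs
      refine two_mul_le_lerayScale ha hρ (hs.2.trans ht₀T) ?_
      have h1 : δ' ≤ δ := min_le_left _ _
      have h2 : T - s < T - t₀ + r₀ ^ 2 := by linarith [hs.1]
      have h3 : T - t₀ = (T - t) / 2 := by rw [ht₀]; ring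
      rw [hδ] at h1 hr₀δ
      linarith
    have hsmall : ∫⁻ w in parabolicCylinder r₀ (t₀, x₀),
        (‖u w.1 w.2‖ₑ ^ (3 : ℕ) + ‖p w.1 w.2‖ₑ ^ (3 / 2 : ℝ)) ≤ ENNReal.ofReal (ε₀ ^ 3 * r₀ ^ 2) := by
      have := lintegral_parabolicCylinder_selfSimilar_le (T := T) hUm hPm ha c hx₀ hr₀h ht₀T.le
        hlow hUη.le hPη.le
      rw [h2η, ← ENNReal.ofReal_mul (by positivity)] at this
      exact this
    have hae := H W u p hsws (t₀, x₀) r₀ 1 hr₀0 (by linarith) hbox hsmall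
    -- from a.e. to everywhere on the open cylinder, then at the point `(t, x₀)`
    have hVW : parabolicCylinder (r₀ / 2) (t₀, x₀) ⊆ (W : Set (ℝ × ℝ³)) := by
      rw [hW]
      rintro ⟨s, z⟩ hs
      rw [mem_parabolicCylinder] at hs
      exact ⟨lt_trans hs.1.2 ht₀T, mem_univ _⟩
    have hall := forall_norm_le_of_ae_restrict hucont (isOpen_parabolicCylinder _ _) hVW hae
    have hmem : (t, x₀) ∈ parabolicCylinder (r₀ / 2) (t₀, x₀) := by
      rw [mem_parabolicCylinder]
      exact ⟨⟨hgap, htt₀⟩, by simp [half_pos hr₀0]⟩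
    exact hall (t, x₀) hmem
  -- ## rescaling (3.3): `u(t, y/|y|) = |y| U(y)` at the time with `λ(t) = |y|`
  set R : ℝ := Real.sqrt (1 / (2 * a * δ')) + 1 with hR
  refine ⟨M, R, fun y hy => ?_⟩
  have hR0 : 0 ≤ Real.sqrt (1 / (2 * a * δ')) := Real.sqrt_nonneg _
  have hy0 : 0 < ‖y‖ := by linarith
  have hy1 : 1 / (2 * a * δ') < ‖y‖ ^ 2 := by
    have h1 : Real.sqrt (1 / (2 * a * δ')) < ‖y‖ := by linarith
    calc 1 / (2 * a * δ') = (Real.sqrt (1 / (2 * a * δ'))) ^ 2 := (Real.sq_sqrt (by positivity)).symm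
      _ < ‖y‖ ^ 2 := pow_lt_pow_left₀ h1 hR0 two_ne_zero
  set t : ℝ := T - 1 / (2 * a * ‖y‖ ^ 2) with htdef
  have htT : t < T := by rw [htdef]; linarith [show 0 < 1 / (2 * a * ‖y‖ ^ 2) by positivity]
  have htδ : T - δ' < t := by
    rw [htdef]
    have : 1 / (2 * a * ‖y‖ ^ 2) < δ' := by
      rw [div_lt_iff₀ (by positivity)]
      rw [div_lt_iff₀ (by positivity)] at hy1
      nlinarith
    linarith
  have hscale : (Real.sqrt (2 * a * (T - t)))⁻¹ = ‖y‖ := by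
    have e : 2 * a * (T - t) = (‖y‖⁻¹) ^ 2 := by
      rw [htdef]; field_simp; ring
    rw [e, Real.sqrt_sq (inv_nonneg.2 hy0.le), inv_inv]
  set x₀ : ℝ³ := ‖y‖⁻¹ • y with hx₀def
  have hx₀ : ‖x₀‖ = 1 := by
    rw [hx₀def, norm_smul, norm_inv, norm_norm, inv_mul_cancel₀ hy0.ne']
  have hux : u t x₀ = ‖y‖ • U y := by
    show lerayBackward a T U t x₀ = ‖y‖ • U y
    rw [lerayBackward_apply, hscale, hx₀def, smul_smul, mul_inv_cancel₀ hy0.ne', one_smul]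
  have := hbound x₀ hx₀ t htδ htT
  rw [hux, norm_smul, Real.norm_of_nonneg hy0.le] at this
  exact this

/-- **NRŠ 1996, (3.5)–(3.6) with `k = 0` and (3.3): `L³` profiles decay like `|y|⁻¹`**
(Acta Math. 176, pp. 288–289; Tsai 1998, (3.11) for `q = 3`). Let `ν > 0`, `a > 0`, let
`(U, P)` be a Leray profile (`IsLerayProfile ν a U P`: `U ∈ C²`, `P ∈ C¹`, (1.3) pointwise) with
`U ∈ L³(ℝ³)`, and assume the pressure is normalised in `L^{3/2}` up to a constant,
`P − c ∈ L^{3/2}(ℝ³)` (NRŠ Lemma 3.1, the tree's `nrs1996_lemma31`). Granted the one-scale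
ε-regularity criterion (`lemarieRieusset_epsilon_regularity`, NRŠ's Proposition 2.1 for `k = 0`),
there are `C, R` with `|y| |U(y)| ≤ C` for all `|y| ≥ R`: the instance of
`IsLerayProfile.exists_forall_norm_mul_norm_le_of_oneScale` fed by
`epsilonRegularity_of_isSuitableWeakSolutionOn`. [cite: NecasRuzickaSverak1996, Lemma 3.2 proof (3.3)–(3.6) pp. 288–289] -/
theorem IsLerayProfile.exists_forall_norm_mul_norm_le (hLR : lemarieRieusset_epsilon_regularity)
    {ν a : ℝ} (hν : 0 < ν) (ha : 0 < a) {U : ℝ³ → ℝ³} {P : ℝ³ → ℝ} (h : IsLerayProfile ν a U P)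
    (hU3 : MemLp U 3 volume) {c : ℝ} (hPc : MemLp (fun y => P y - c) (3 / 2 : ℝ≥0∞) volume) :
    ∃ C R : ℝ, ∀ y, R ≤ ‖y‖ → ‖y‖ * ‖U y‖ ≤ C := by
  obtain ⟨ε₀, C₀, hε₀, -, H⟩ := epsilonRegularity_of_isSuitableWeakSolutionOn hLR hν
  exact h.exists_forall_norm_mul_norm_le_of_oneScale ha hε₀ H hU3 hPc

/-! ### The assembly -/

/-- **NRŠ 1996, Theorem 1, from ε-regularity.** Granted the regularity of weak solutions of
(1.3) (`tsai1998_profile_smooth`, NRŠ p. 287 = Tsai p. 33), the polynomial growth of the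
pressure (`tsai1998_lemma32`, Tsai's Lemma 3.2, stated for `3 ≤ q ≤ ∞`), the one-scale
Caffarelli–Kohn–Nirenberg criterion (`lemarieRieusset_epsilon_regularity`, NRŠ's
Proposition 2.1 for `k = 0`) and the `L^{3/2}` pressure of Lemma 3.1 (`nrs1996_lemma31`),
every Leray profile `U ∈ L³(ℝ³)` vanishes (`necas_ruzicka_sverak`): by
`IsLerayProfile.exists_forall_norm_mul_norm_le`, `|y| |U(y)| ≤ C` for `|y| ≥ R` (NRŠ (3.6),
`k = 0`), hence `|U(y)| ≤ (a/2)|y|` far out; with `|P(y)| ≤ C'|y|^N` the proved endgame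
`IsLerayProfile.eq_zero_of_growth` (NRŠ Lemma 3.3 / Tsai (1.7), Tsai's Lemma 5.1, `ΔU = 0` and
the harmonic Liouville theorem in `L³`) gives `U = 0`, exactly as in
`tsai_selfsimilar_local_energy_of_lemma32`. [cite: NecasRuzickaSverak1996, Thm 1 (p. 291)] -/
theorem necas_ruzicka_sverak_of_epsilonRegularity (hreg : tsai1998_profile_smooth)
    (h32 : tsai1998_lemma32) (hLR : lemarieRieusset_epsilon_regularity)
    (h31 : nrs1996_lemma31) : necas_ruzicka_sverak := by
  intro ν a hν ha U P hprof hU3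
  obtain ⟨c, hPc⟩ := h31 hν ha hprof hU3
  obtain ⟨C, R, hdecay⟩ := hprof.exists_forall_norm_mul_norm_le hLR hν ha hU3 hPc
  have hU3' : ContDiff ℝ 3 U := contDiff_infty.1 (hreg hν ha hprof) 3
  have hP2 : ContDiff ℝ 2 P := hprof.contDiff_two_pressure hU3'
  obtain ⟨N, C', R', hPR⟩ := h32 hν ha hprof (le_refl _) hU3
  -- `|y| |U(y)| ≤ C` for `|y| ≥ R` gives `|U(y)| ≤ (a/2)|y|` for `|y| ≥ max (max R 1) (2|C|/a)`
  have hUb : ∀ y : ℝ³, max (max R 1) (2 * |C| / a) ≤ ‖y‖ → ‖U y‖ ≤ a / 2 * ‖y‖ := by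
    intro y hy
    have hR : R ≤ ‖y‖ := le_trans (le_trans (le_max_left _ _) (le_max_left _ _)) hy
    have h1 : 1 ≤ ‖y‖ := le_trans (le_trans (le_max_right _ _) (le_max_left _ _)) hy
    have h2 : 2 * |C| / a ≤ ‖y‖ := le_trans (le_max_right _ _) hy
    have h2' : 2 * |C| ≤ a * ‖y‖ := by rwa [div_le_iff₀' ha] at h2
    have hd : ‖y‖ * ‖U y‖ ≤ |C| := (hdecay y hR).trans (le_abs_self C)
    have h3 : ‖y‖ * ‖U y‖ ≤ ‖y‖ * (a / 2) := by nlinarith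
    have h4 : ‖U y‖ ≤ a / 2 := le_of_mul_le_mul_left h3 (by linarith)
    nlinarith
  exact hprof.eq_zero_of_growth hν ha hU3' hP2 (half_pos ha).le (half_lt_self ha) hUb hPR
    (by norm_num) ENNReal.ofNat_ne_top hU3

end Literature.Analysis.FluidPDE

end
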